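import Literature.Claims.NS.Dahlke2026
import Literature.Analysis.FluidPDE.NSFiniteEnergySmoothProofs
import Literature.Analysis.FluidPDE.ClayDataSobolev
import HarnessLib

/-!
# Solo salvage for claim C165 `Dahlke2026` (cell `ns-claims`, D-0090): the energy-class binder
# `Step_Energy` (§15.7 p.62 l.68–85) HOLDS — Leray's energy inequality for finite-energy classical
# solutions from Clay data

Claim C165: Dahlke, «Global Regularity for 3D Navier–Stokes via Critical Budgets and Rigidity» (Zenodo
18905486 v10, 2026); skeleton `Literature.Claims.NS.Dahlke2026` (typist-6 g6, p538219). Binder hE of its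
composition `claim_of_steps (h153) (h1511) (h157) (hE) (hL3)` is the energy class of §15.7: every
finite-energy classical solution `(u, p)` of the unforced system (viscosity `1`) on `[0,T) × ℝ³` from a
Clay datum admits `M > 0` with `sup_{(0,T)} ∫|u|² + ∫∫_{(0,T)×ℝ³} |∇u|²_F ≤ M²`. This is Leray's energy
inequality; the tree PROVES it for finite-energy classical solutions on every CLOSED slab `[0,T′]` with a
`T′`-uniform constant (`Literature.Analysis.FluidPDE.tao_finite_energy_smooth_energy_bound_holds`:
`∫|u(t)|² ≤ C∫|u₀|²`, `ν∫₀^{T′}∫|∇u|²_F ≤ C∫|u₀|²`). Here: restrict the half-open slab to `[0,T′]`,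
`T′ ↑ T` by monotone convergence (`setLIntegral_iUnion_of_directed`), Tonelli's inequality
(`lintegral_prod_le`) for the product-set form, and `∫|u₀|² < ∞` from the rapid decay
(`HasRapidSpatialDecay.lintegral_enorm_sq_lt_top`).

* `step_Energy_holds : Literature.Claims.NS.Dahlke2026.Step_Energy`.

TRUE mathematics only; salvage seat `ns-claims-salvage-p5` g4. Solo lane (no item).

WHAT THIS IS NOT: not a claim about NS regularity or blow-up; not a claim about any author beyond the typed
locator.
-/

-- lint debt (one line): the Theorems namespace repeats the summit name by the D-0017 layout.
set_option linter.dupNamespace false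

noncomputable section

open Set Filter MeasureTheory Topology
open scoped ENNReal NNReal

namespace Summit.NavierStokesRegularity.NavierStokesRegularity.Theorems.Dahlke2026Salvage

open Literature.Analysis.FluidPDE
open Literature.Claims.NS.Dahlke2026

/-- `(0, T) = ⋃ₙ (0, T − T/(n+2))` for `T > 0` (Archimedes). [folklore] -/
theorem iUnion_Ioo_shrink {T : ℝ} (hT : 0 < T) :
    (⋃ n : ℕ, Ioo (0 : ℝ) (T - T / (n + 2))) = Ioo 0 T := by
  ext t
  simp only [mem_iUnion, mem_Ioo]
  constructor
  · rintro ⟨n, h0, h1⟩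
    have : 0 < T / (n + 2) := by positivity
    exact ⟨h0, by linarith⟩
  · rintro ⟨h0, h1⟩
    obtain ⟨n, hn⟩ := exists_nat_gt (T / (T - t))
    have hTt : 0 < T - t := by linarith
    refine ⟨n, h0, ?_⟩
    have h2 : (0 : ℝ) < n + 2 := by positivity
    have h3 : T / (T - t) < n + 2 := by linarith
    have h4 : T < (n + 2) * (T - t) := by rwa [div_lt_iff₀ hTt] at h3
    have h5 : T / (n + 2) < T - t := by rw [div_lt_iff₀ h2]; linarith
    linarith

/-- **`Step_Energy` of C165 HOLDS** (§15.7 p.62 l.68–85; Leray's energy inequality): every finite-energy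
classical solution of the unforced Navier–Stokes system with viscosity `1` on `[0,T) × ℝ³` from a Clay datum
has `sup_{t ∈ (0,T)} ∫|u(t)|² + ∫∫_{(0,T) × ℝ³} |∇u|²_F ≤ M²` for some `M > 0`.
[cite: Dahlke2026, §15.7 p.62 l.68–85] [cite: Leray1934, (2.18) p. 241] -/
theorem step_Energy_holds : Step_Energy := by
  intro T hT u₀ u p hu₀ hsol
  obtain ⟨hcl, hu0, A, hA, hAbd⟩ := hsol
  obtain ⟨C, hC, hCprop⟩ := tao_finite_energy_smooth_energy_bound_holds
  -- the datum's energy is finite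
  set E0 : ℝ≥0∞ := ∫⁻ x, ‖u 0 x‖ₑ ^ 2 with hE0def
  have hE0 : E0 < ⊤ := by
    rw [hE0def, hu0]
    exact hu₀.2.2.lintegral_enorm_sq_lt_top
  -- Leray's inequality on every closed sub-slab `[0, T′]`, `0 < T′ < T`, with the uniform constant
  have key : ∀ T' : ℝ, 0 < T' → T' < T →
      (∀ t ∈ Icc 0 T', ∫⁻ x, ‖u t x‖ₑ ^ 2 ≤ C * E0) ∧
        ∫⁻ t in Ioo 0 T', ∫⁻ x, ENNReal.ofReal (frobeniusNormSq (fderiv ℝ (u t) x)) ≤ C * E0 := by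
    intro T' h1 h2
    have hcl' : IsClassicalNSSolutionOn (Icc 0 T') 1 0 u p :=
      hcl.mono (Icc_subset_Ico_right h2) (uniqueDiffOn_Icc h1)
    have hfe : ∃ A : ℝ≥0∞, A < ⊤ ∧ ∀ t ∈ Icc 0 T', ∫⁻ x, ‖u t x‖ₑ ^ 2 ≤ A :=
      ⟨A, hA, fun t ht => hAbd t ⟨ht.1, lt_of_le_of_lt ht.2 h2⟩⟩
    obtain ⟨hsup, hdiss⟩ := hCprop 1 T' one_pos h1 u p hcl' hfe
    refine ⟨hsup, ?_⟩
    simpa only [ENNReal.ofReal_one, one_mul] using hdiss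
  -- the bound, as an extended real
  set K : ℝ≥0∞ := C * E0 + C * E0 with hKdef
  have hKtop : K ≠ ⊤ := by
    have : C * E0 ≠ ⊤ := ENNReal.mul_ne_top hC.ne hE0.ne
    exact ENNReal.add_ne_top.2 ⟨this, this⟩
  -- (1) the sup over `(0,T)`
  have hS : (⨆ t ∈ Ioo 0 T, ∫⁻ x, ‖u t x‖ₑ ^ 2) ≤ C * E0 := by
    refine iSup₂_le fun t ht => ?_
    have h2 : (t + T) / 2 < T := by linarith [ht.2]
    have h1 : 0 < (t + T) / 2 := by linarith [ht.1]
    exact (key _ h1 h2).1 t ⟨ht.1.le, by linarith [ht.2]⟩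
  -- (2) the space–time integral: Tonelli's inequality, then `T′ ↑ T`
  have hI : (∫⁻ q in Ioo 0 T ×ˢ (univ : Set E3),
      ENNReal.ofReal (frobeniusNormSq (fderiv ℝ (u q.1) q.2))) ≤ C * E0 := by
    have hprod : (volume : Measure (ℝ × E3)).restrict (Ioo 0 T ×ˢ (univ : Set E3)) =
        ((volume : Measure ℝ).restrict (Ioo 0 T)).prod ((volume : Measure E3).restrict univ) := by
      rw [Measure.volume_eq_prod, Measure.prod_restrict]
    calc (∫⁻ q in Ioo 0 T ×ˢ (univ : Set E3), ENNReal.ofReal (frobeniusNormSq (fderiv ℝ (u q.1) q.2)))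
        ≤ ∫⁻ t in Ioo 0 T, ∫⁻ x in (univ : Set E3),
            ENNReal.ofReal (frobeniusNormSq (fderiv ℝ (u t) x)) := by
          rw [hprod]; exact lintegral_prod_le _
      _ = ∫⁻ t in Ioo 0 T, ∫⁻ x, ENNReal.ofReal (frobeniusNormSq (fderiv ℝ (u t) x)) := by
          simp only [Measure.restrict_univ]
      _ ≤ C * E0 := by
          rw [← iUnion_Ioo_shrink hT, setLIntegral_iUnion_of_directed _ ?_]
          · refine iSup_le fun n => ?_
            have hpos : 0 < T / ((n : ℝ) + 2) := by positivity
            have hlt : T / ((n : ℝ) + 2) < T := by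
              rw [div_lt_iff₀ (by positivity : (0 : ℝ) < n + 2)]; nlinarith
            exact (key (T - T / (n + 2)) (by linarith) (by linarith)).2
          · refine Monotone.directed_le fun m n hmn => Ioo_subset_Ioo_right ?_
            have h2m : (0 : ℝ) < m + 2 := by positivity
            gcongr
  -- assemble: `M² := K.toReal + 1`
  refine ⟨Real.sqrt (K.toReal + 1), Real.sqrt_pos.2 (by positivity), ?_⟩
  unfold EnergyBound
  rw [Real.sq_sqrt (by positivity)]
  calc (⨆ t ∈ Ioo 0 T, ∫⁻ x, ‖u t x‖ₑ ^ 2) +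
        (∫⁻ q in Ioo 0 T ×ˢ (univ : Set E3), ENNReal.ofReal (frobeniusNormSq (fderiv ℝ (u q.1) q.2)))
      ≤ C * E0 + C * E0 := add_le_add hS hI
    _ = ENNReal.ofReal K.toReal := (ENNReal.ofReal_toReal hKtop).symm
    _ ≤ ENNReal.ofReal (K.toReal + 1) := ENNReal.ofReal_le_ofReal (by linarith)

end Summit.NavierStokesRegularity.NavierStokesRegularity.Theorems.Dahlke2026Salvage

end

-- WHAT THIS IS NOT: not a claim about NS regularity or blow-up; not a claim about any author beyond the
-- typed locator.
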